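import Literature.NumberTheory.Automorphic.UnboundedDenominatorsFields
import Literature.NumberTheory.Automorphic.ModularLambdaDeckRigidity
import Literature.NumberTheory.EllipticCurves.ModularCurveGammaIndex
import HarnessLib

/-!
# The unbounded denominators theorem (Calegari–Dimitrov–Tang) — (4.3.3): stabilisers of the dilates `λ(dτ)` and the index of `Γ(N)`

PROOF-ONLY sequel (no definition, no named fact; D-0026) of `UnboundedDenominatorsFields.lean`
(the weight-`0` action of `SL(2, ℤ)` on `𝓗` and `Mer`) and `ModularLambdaDeckRigidity.lean`
(a Möbius transformation preserving `λ` is `± γ`, `γ ∈ Γ(2)`). Source: F. Calegari, V. Dimitrov,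
Y. Tang, *The unbounded denominators conjecture*, J. Amer. Math. Soc. **38** (2025), §4.2,
display (4.3.3): `[M_N : M_2] = ½ [Γ(2) : Γ(N)] = (N³/2[SL₂(ℤ):Γ(2)]) ∏_{p∣N}(1 − p⁻²) > N³/(12 ζ(2))`.

For the lower bound `[M_N : M_2] ≥ c N³` (the direction used by Theorem 1.0.1) we bound the
pointwise stabiliser of `M_N` in `Γ(2)` and count: this file provides

* ★ `dvd_of_smul_modularLambda_dilate_eq` — **the stabiliser of `λ(dτ)` forces `2d ∣ c`**: if
  `γ ∈ SL(2, ℤ)` fixes the element `λ(A • ·)` of `Mer` (`A = diag(d, 1)`), then `2d ∣ γ₁₀`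
  (conjugate `γ⁻¹` by `A`, apply deck rigidity, read off the lower-left entry);
* ★ `pow_three_le_two_mul_index_Gamma` — **`N³ ≤ 2 · [SL₂(ℤ) : Γ(N)]`** for `N ≥ 1`, from the
  tree's exact index formula `index_Gamma` and the telescoping bound
  `∏_{p ∣ N} (1 − p⁻²) ≥ ∏_{n=2}^{M} (1 − n⁻²) = (M+1)/(2M) ≥ ½`;
* `index_Gamma_two` — `[SL₂(ℤ) : Γ(2)] = 6`.

## References

* [CalegariDimitrovTang2025] F. Calegari, V. Dimitrov, Y. Tang, The unbounded denominators
  conjecture, J. Amer. Math. Soc. 38 (2025), no. 3, 627–702; arXiv:2109.09040. §4.2 (4.3.3).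
* [DiamondShurman2005] F. Diamond, J. Shurman, A First Course in Modular Forms, §1.2.
-/

noncomputable section

namespace Literature.NumberTheory.Automorphic

open scoped MatrixGroups ModularForm
open UpperHalfPlane CongruenceSubgroup Matrix.SpecialLinearGroup ModularGroup
open Literature.NumberTheory.Automorphic.ModularLambda

namespace UnboundedDenominators

/-! ### §1. The stabiliser of `λ(dτ)` -/

/-- Entries of `mapGL ℝ γ`. [folklore] -/
private lemma mapGL_apply (γ : SL(2, ℤ)) (i j : Fin 2) :
    ((mapGL ℝ γ : GL (Fin 2) ℝ) : Matrix (Fin 2) (Fin 2) ℝ) i j = ((γ i j : ℤ) : ℝ) := by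
  simp [mapGL]

/-- ★ **The stabiliser of `λ(dτ)` in `SL(2, ℤ)` lies in `Γ₀(2d)`** [cite: CalegariDimitrovTang2025,
§4.2 (4.3.3) (the degree of `Y(N) → Y(2)`)]: let `A = diag(d, 1)` (`d > 0` perforce, so `A • τ = dτ`) and
let `Λ ∈ 𝓗` be the holomorphic function `τ ↦ λ(A • τ)`. If `γ ∈ SL(2, ℤ)` fixes `Λ` (as an
element of `Mer`, under the weight-`0` action), then `2d ∣ γ₁₀`. Indeed `g = A γ⁻¹ A⁻¹ ∈ GL₂(ℝ)⁺`
preserves `λ`, so `g = ± γ₂` with `γ₂ ∈ Γ(2)` (`ModularLambdaDeckRigidity`), and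
`g₁₀ = -γ₁₀/d`. -/
theorem dvd_of_smul_modularLambda_dilate_eq {d : ℕ} {A : GL (Fin 2) ℝ}
    (hA : (A : Matrix (Fin 2) (Fin 2) ℝ) = !![(d : ℝ), 0; 0, 1])
    {Λ : hol} (hΛ : (Λ : ℍ → ℂ) = fun τ : ℍ ↦ modularLambda ((A • τ : ℍ) : ℂ))
    {γ : SL(2, ℤ)} (hγ : γ • algebraMap hol Mer Λ = algebraMap hol Mer Λ) :
    (2 * d : ℤ) ∣ γ 1 0 := by
  -- `γ • Λ = Λ` in `𝓗`, i.e. `λ(A γ⁻¹ τ) = λ(A τ)` for all `τ`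
  rw [smul_algebraMap] at hγ
  have hΛγ : γ • Λ = Λ := algebraMap_hol_injective hγ
  have hpt : ∀ τ : ℍ, modularLambda ((A • (γ⁻¹ • τ) : ℍ) : ℂ) = modularLambda ((A • τ : ℍ) : ℂ) := by
    intro τ
    have := congrArg (fun f : hol ↦ (f : ℍ → ℂ) τ) hΛγ
    simpa only [smul_hol_apply, hΛ] using this
  -- the positive-determinant element `g = A γ⁻¹ A⁻¹` preserves `λ`
  set g : GL (Fin 2) ℝ := A * mapGL ℝ γ⁻¹ * A⁻¹ with hg
  have hAdet : A.det.val = d := by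
    rw [Matrix.GeneralLinearGroup.val_det_apply, hA, Matrix.det_fin_two_of]; ring
  have hgdet1 : g.det = 1 := by
    have h1 : ((mapGL ℝ γ⁻¹).det : ℝˣ) = 1 := Units.val_eq_one.mp (by simp)
    rw [hg, map_mul, map_mul, h1, mul_one, map_inv, mul_inv_cancel]
  have hgdet : 0 < g.det.val := by rw [hgdet1, Units.val_one]; exact one_pos
  have hlg : ∀ w : ℍ, modularLambda ((g • w : ℍ) : ℂ) = modularLambda (w : ℂ) := by
    intro w
    have e : g • w = A • (γ⁻¹ • (A⁻¹ • w)) := by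
      rw [hg, mul_smul, mul_smul]
      rfl
    rw [e, hpt (A⁻¹ • w), smul_inv_smul]
  obtain ⟨γ₂, hγ₂, r, hr⟩ := exists_mem_Gamma_two_eq_smul_of_forall_modularLambda_smul_eq hgdet hlg
  -- entries: `d · g₁₀ = -γ₁₀` and `g₁₀ = r (γ₂)₁₀`, `r = ±1`
  have hgA : (g : Matrix (Fin 2) (Fin 2) ℝ) * (A : Matrix (Fin 2) (Fin 2) ℝ) =
      (A : Matrix (Fin 2) (Fin 2) ℝ) * ((mapGL ℝ γ⁻¹ : GL (Fin 2) ℝ) : Matrix (Fin 2) (Fin 2) ℝ) := by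
    rw [← Units.val_mul, ← Units.val_mul, hg, inv_mul_cancel_right]
  have h10 : (d : ℝ) * (g : Matrix (Fin 2) (Fin 2) ℝ) 1 0 = -((γ 1 0 : ℤ) : ℝ) := by
    have e := congrArg (fun M : Matrix (Fin 2) (Fin 2) ℝ ↦ M 1 0) hgA
    simp only [Matrix.mul_apply, Fin.sum_univ_two, hA, mapGL_apply, Matrix.of_apply,
      Matrix.cons_val', Matrix.cons_val_zero, Matrix.cons_val_one, Matrix.empty_val',
      Matrix.cons_val_fin_one, Matrix.SpecialLinearGroup.SL2_inv_expl] at e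
    push_cast at e
    linear_combination e
  have h10' : (g : Matrix (Fin 2) (Fin 2) ℝ) 1 0 = r * ((γ₂ 1 0 : ℤ) : ℝ) := by
    have e := congrArg (fun M : Matrix (Fin 2) (Fin 2) ℝ ↦ M 1 0) hr
    simpa only [Matrix.smul_apply, mapGL_apply, smul_eq_mul] using e
  have hr1 : r * r = 1 := by
    have e := congrArg Matrix.det hr
    rw [Matrix.det_smul, Fintype.card_fin, ← Matrix.GeneralLinearGroup.val_det_apply,
      ← Matrix.GeneralLinearGroup.val_det_apply, hgdet1, Units.val_one] at e
    have hγ₂det : ((mapGL ℝ γ₂ : GL (Fin 2) ℝ).det : ℝˣ).val = 1 := by simp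
    rw [hγ₂det, mul_one] at e
    linear_combination -e
  have heven : (2 : ℤ) ∣ γ₂ 1 0 := by
    obtain ⟨-, -, h, -⟩ := Gamma_mem.mp hγ₂
    exact (ZMod.intCast_zmod_eq_zero_iff_dvd _ 2).mp h
  obtain ⟨k, hk⟩ := heven
  -- `γ₁₀ = -d r (γ₂)₁₀ = ∓ 2 d k`
  have hreal : ((γ 1 0 : ℤ) : ℝ) = -(d : ℝ) * r * (2 * k : ℤ) := by
    rw [← hk]; linear_combination h10 - (d : ℝ) * h10'
  rcases mul_self_eq_one_iff.mp hr1 with rfl | rfl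
  · refine ⟨-k, ?_⟩
    have : ((γ 1 0 : ℤ) : ℝ) = ((2 * d * (-k) : ℤ) : ℝ) := by rw [hreal]; push_cast; ring
    exact_mod_cast this
  · refine ⟨k, ?_⟩
    have : ((γ 1 0 : ℤ) : ℝ) = ((2 * d * k : ℤ) : ℝ) := by rw [hreal]; push_cast; ring
    exact_mod_cast this

/-! ### §2. The index of `Γ(N)` -/

/-- The telescoping product `∏_{n=2}^{M} (1 − 1/n²) = (M + 1)/(2M)` for `M ≥ 1`. [folklore] -/
private theorem prod_Icc_one_sub_inv_sq (M : ℕ) (hM : 1 ≤ M) :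
    ∏ n ∈ Finset.Icc 2 M, (1 - 1 / ((n : ℝ)) ^ 2) = ((M : ℝ) + 1) / (2 * M) := by
  induction M, hM using Nat.le_induction with
  | base => norm_num
  | succ M hM ih =>
    rw [Finset.prod_Icc_succ_top (by omega), ih]
    have hM0 : (M : ℝ) ≠ 0 := by exact_mod_cast (by omega : M ≠ 0)
    have hM1 : (M : ℝ) + 1 ≠ 0 := by positivity
    push_cast
    field_simp
    ring

/-- `∏_{p ∈ S} (1 − 1/p²) ≥ 1/2` for any finite set `S` of integers `≥ 2`. [folklore] -/
private theorem half_le_prod_one_sub_inv_sq (S : Finset ℕ) (hS : ∀ p ∈ S, 2 ≤ p) :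
    (1 / 2 : ℝ) ≤ ∏ p ∈ S, (1 - 1 / ((p : ℝ)) ^ 2) := by
  classical
  rcases S.eq_empty_or_nonempty with rfl | hne
  · norm_num
  set M := S.max' hne with hM
  have hM2 : 2 ≤ M := (hS _ (S.min'_mem hne)).trans (S.min'_le_max' hne) |>.trans le_rfl
  have hsub : S ⊆ Finset.Icc 2 M := fun p hp ↦
    Finset.mem_Icc.mpr ⟨hS p hp, S.le_max' p hp⟩
  have hfac0 : ∀ n ∈ Finset.Icc 2 M, (0 : ℝ) ≤ 1 - 1 / ((n : ℝ)) ^ 2 := by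
    intro n hn
    have h2 : (2 : ℝ) ≤ n := by exact_mod_cast (Finset.mem_Icc.mp hn).1
    rw [sub_nonneg, div_le_one (by positivity)]
    nlinarith
  have hfac1 : ∀ n ∈ Finset.Icc 2 M, 1 - 1 / ((n : ℝ)) ^ 2 ≤ 1 := fun n _ ↦ by
    have : (0 : ℝ) ≤ 1 / ((n : ℝ)) ^ 2 := by positivity
    linarith
  calc (1 / 2 : ℝ) ≤ ((M : ℝ) + 1) / (2 * M) := by
        rw [div_le_div_iff₀ (by norm_num) (by positivity)]; linarith
    _ = ∏ n ∈ Finset.Icc 2 M, (1 - 1 / ((n : ℝ)) ^ 2) :=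
        (prod_Icc_one_sub_inv_sq M (by omega)).symm
    _ = (∏ n ∈ Finset.Icc 2 M \ S, (1 - 1 / ((n : ℝ)) ^ 2)) *
          ∏ p ∈ S, (1 - 1 / ((p : ℝ)) ^ 2) := (Finset.prod_sdiff hsub).symm
    _ ≤ 1 * ∏ p ∈ S, (1 - 1 / ((p : ℝ)) ^ 2) := by
        apply mul_le_mul_of_nonneg_right
        · exact Finset.prod_le_one (fun n hn ↦ hfac0 n (Finset.sdiff_subset hn))
            (fun n hn ↦ hfac1 n (Finset.sdiff_subset hn))
        · exact Finset.prod_nonneg fun p hp ↦ hfac0 p (hsub hp)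
    _ = ∏ p ∈ S, (1 - 1 / ((p : ℝ)) ^ 2) := one_mul _

/-- ★ **`N³ ≤ 2 · [SL₂(ℤ) : Γ(N)]`** for `N ≥ 1` [cite: DiamondShurman2005, §1.2 p. 13 and
Exercise 1.2.3(b)]: `[SL₂(ℤ) : Γ(N)] = N³ ∏_{p∣N} (1 − p⁻²)` (`index_Gamma`) and
`∏_{p∣N}(1 − p⁻²) ≥ ½`. This is the lower bound in CDT's display (4.3.3),
`[M_N : M_2] > N³/(12 ζ(2))`. -/
theorem pow_three_le_two_mul_index_Gamma (N : ℕ) [NeZero N] : N ^ 3 ≤ 2 * (Gamma N).index := by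
  classical
  have hN : N ≠ 0 := NeZero.ne N
  rw [Literature.NumberTheory.EllipticCurves.ModularForms.index_Gamma N]
  set P : ℕ := N.factorization.prod fun p k ↦ p ^ (k - 1) * (p + 1) * (p ^ (k - 1) * (p - 1))
    with hP
  -- reduce to `N² ≤ 2 P`, proved over `ℝ`
  suffices h : N ^ 2 ≤ 2 * P by
    calc N ^ 3 = N * N ^ 2 := by ring
      _ ≤ N * (2 * P) := Nat.mul_le_mul_left _ h
      _ = 2 * (N * P) := by ring
  suffices h : ((N : ℝ)) ^ 2 ≤ 2 * (P : ℝ) by exact_mod_cast h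
  -- `N² = ∏ p^{2k}` and `P = ∏ p^{2k-2} (p² - 1) = ∏ p^{2k} (1 - 1/p²)`
  have hNprod : ((N : ℝ)) ^ 2 = ∏ p ∈ N.primeFactors, ((p : ℝ)) ^ (2 * N.factorization p) := by
    conv_lhs => rw [← Nat.prod_factorization_pow_eq_self hN]
    rw [Nat.cast_finsuppProd, Finsupp.prod, Nat.support_factorization, ← Finset.prod_pow]
    refine Finset.prod_congr rfl fun p _ ↦ ?_
    push_cast
    ring
  have hfac : (P : ℝ) =
      ∏ p ∈ N.primeFactors, ((p : ℝ)) ^ (2 * N.factorization p) * (1 - 1 / ((p : ℝ)) ^ 2) := by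
    rw [hP, Nat.cast_finsuppProd, Finsupp.prod, Nat.support_factorization]
    refine Finset.prod_congr rfl fun p hp ↦ ?_
    have hp2 : 2 ≤ p := (Nat.prime_of_mem_primeFactors hp).two_le
    have hk : 1 ≤ N.factorization p :=
      Nat.one_le_iff_ne_zero.mpr (Finsupp.mem_support_iff.mp hp)
    have hp0 : (p : ℝ) ≠ 0 := by exact_mod_cast (by omega : p ≠ 0)
    obtain ⟨k, hk'⟩ := Nat.exists_eq_add_of_le hk
    rw [hk']
    push_cast [Nat.cast_sub (by omega : 1 ≤ p)]
    simp only [add_tsub_cancel_left]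
    field_simp
    ring
  rw [hNprod, hfac, Finset.prod_mul_distrib]
  have hpos : (0 : ℝ) ≤ ∏ p ∈ N.primeFactors, ((p : ℝ)) ^ (2 * N.factorization p) :=
    Finset.prod_nonneg fun p _ ↦ by positivity
  have hhalf := half_le_prod_one_sub_inv_sq N.primeFactors
    fun p hp ↦ (Nat.prime_of_mem_primeFactors hp).two_le
  nlinarith

/-- **`[SL₂(ℤ) : Γ(2)] = 6`.** [cite: DiamondShurman2005, §1.2 p. 13] -/
theorem index_Gamma_two : (Gamma 2).index = 6 := by
  haveI : NeZero (2 : ℕ) := ⟨two_ne_zero⟩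
  rw [Literature.NumberTheory.EllipticCurves.ModularForms.index_Gamma 2,
    Nat.Prime.factorization Nat.prime_two, Finsupp.prod, Finsupp.support_single _ one_ne_zero,
    Finset.prod_singleton, Finsupp.single_eq_same]
  norm_num

end UnboundedDenominators

end Literature.NumberTheory.Automorphic

end
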